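import Literature.Analysis.ODE.MaxLyapunovInvariance
import Literature.Analysis.ODE.LyapunovBarbashinKrasovskii
import Mathlib.Analysis.Calculus.Deriv.MeanValue
import Mathlib.Order.ConditionallyCompleteLattice.Finset
import HarnessLib

/-!
# Vector Lyapunov functions: the Kundu–Anghel level-descent lemma (compositional certificates)

Topic `Literature/Analysis/ODE` (namespace `Literature.Analysis.ODE`). The soundness statement behind
COMPOSITIONAL / DISTRIBUTED sum-of-squares stability certificates for interconnected systems
`ẋᵢ = fᵢ(xᵢ) + gᵢ(x)` [KunduAnghel2015acc, §4.1 Lemma 1]: one Lyapunov function `Vᵢ` PER SUBSYSTEM and,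
instead of a scalar Lyapunov function of the whole state, a family of strictly decreasing level
sequences `εᵢ⁰ > εᵢ¹ > … → 0` such that every `Vᵢ` strictly decreases on the «shell»
`𝒟ᵢᵏ = {εᵢᵏ⁺¹ ≤ Vᵢ(xᵢ) ≤ εᵢᵏ, Vⱼ(xⱼ) ≤ εⱼᵏ ∀ j ≠ i}` — each such condition is a LOCAL SOS certificate in
the variables of subsystem `i` and its neighbours (eq. (cond_asymptotic_SOS)), so the certificate size
does not grow with the number of subsystems. Conclusion: the box `{Vᵢ ≤ εᵢ⁰ ∀ i}` is a region of
asymptotic stability.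

We type the lemma over an arbitrary real normed space `E` with functionals `Vᵢ : E → ℝ` (the product
structure `x = (x₁,…,x_m)`, `Vᵢ = Vᵢ(xᵢ)` plays no role in the proof) and a FINITE index type, in the
tree's a priori solution convention, following the printed proof (Appendix 7.1): (i) every box
`{Vᵢ ≤ cᵢ}` with `εᵢᵏ⁺¹ ≤ cᵢ ≤ εᵢᵏ` is positively invariant (its active faces lie in the shells) — by
the finite-barrier lemma `forall_le_of_solution_of_active_lt`; (ii) ONE DESCENT STEP (eq. (proof_tk)):
inside the box of level `k`, `Vᵢ` falls below `εᵢᵏ⁺¹` within time `(εᵢᵏ − εᵢᵏ⁺¹)/rᵢᵏ`, where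
`V̇ᵢ ≤ −rᵢᵏ < 0` on `𝒟ᵢᵏ` (the printed `r̄ᵢᵏ := sup_{𝒟ᵢᵏ} V̇ᵢ < 0`, here an explicit hypothesis — what an
SOS certificate with margin delivers — or obtained from compactness, `exists_rate_of_isCompact`), and
then stays below (step (i)); (iii) induction over `k`; (iv) `εᵢᵏ → 0` ⇒ all `Vᵢ(x(t)) < δ` eventually
(eq. (proof_delta) + conclusion), `Vᵢ(x(t)) → 0`, and `x(t) → x₀` when the boxes shrink to `x₀`;
(v) global existence of solutions from the (bounded) top box for `C¹` fields.

## References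
* S. Kundu, M. Anghel, *A sum-of-squares approach to the stability and control of interconnected
  systems using vector Lyapunov functions*, ACC 2015 = arXiv:1501.05266, §4.1 Lemma 1, eq.
  (cond_asymptotic)/(cond_asymptotic_SOS), Appendix 7.1 (proof). Key `KunduAnghel2015acc`.
* (lineage named there) R. Bellman, *Vector Lyapunov functions*, J. SIAM Control 1 (1962); F. N. Bailey,
  J. SIAM Control 3 (1966).
-/

noncomputable section

open Set Filter Metric
open _root_.Topology

namespace Literature.Analysis.ODE

variable {E : Type*} {ι : Type*}

/-- The LEVEL BOX `{x | Vᵢ x ≤ cᵢ ∀ i}` of a family of Lyapunov functionals (the sets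
`{x | ⋂ᵢ Vᵢ(xᵢ) ≤ εᵢ⁰}`, `ℛ_A⁰ = ℛ_{A,1} × ⋯ × ℛ_{A,m}` of the source).
[cite: KunduAnghel2015acc, §4 eq. (ROA)–(ROA2) and §4.1 Lemma 1 (the domain `{⋂ Vᵢ(xᵢ) ≤ εᵢ⁰}`)] -/
def levelBox (V : ι → E → ℝ) (c : ι → ℝ) : Set E := {x | ∀ i, V i x ≤ c i}

/-- Membership in a level box, unfolded. [cite: KunduAnghel2015acc, §4.1 Lemma 1] -/
theorem mem_levelBox_iff {V : ι → E → ℝ} {c : ι → ℝ} {x : E} :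
    x ∈ levelBox V c ↔ ∀ i, V i x ≤ c i := Iff.rfl

/-- The SHELL `𝒟ᵢᵏ := {x | εᵢᵏ⁺¹ ≤ Vᵢ(x) ≤ εᵢᵏ, Vⱼ(x) ≤ εⱼᵏ ∀ j ≠ i}` on which the printed hypothesis
asks `V̇ᵢ < 0`. [cite: KunduAnghel2015acc, §4.1 Lemma 1 eq. (cond_asymptotic) (definition of `𝒟ᵢᵏ`)] -/
def descentShell (V : ι → E → ℝ) (ε : ι → ℕ → ℝ) (i : ι) (k : ℕ) : Set E :=
  {x | ε i (k + 1) ≤ V i x ∧ V i x ≤ ε i k ∧ ∀ j, j ≠ i → V j x ≤ ε j k}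

/-- Membership in a shell, unfolded. [cite: KunduAnghel2015acc, §4.1 Lemma 1 eq. (cond_asymptotic)] -/
theorem mem_descentShell_iff {V : ι → E → ℝ} {ε : ι → ℕ → ℝ} {i : ι} {k : ℕ} {x : E} :
    x ∈ descentShell V ε i k ↔
      ε i (k + 1) ≤ V i x ∧ V i x ≤ ε i k ∧ ∀ j, j ≠ i → V j x ≤ ε j k := Iff.rfl

/-- **Uniform decrease rate from compactness** (the printed `r̄ᵢᵏ := sup_{x ∈ 𝒟ᵢᵏ} V̇ᵢ(x) < 0`, which the
source uses without comment): if the shell is compact, `V̇ᵢ` is continuous on it and `< 0` pointwise,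
then `V̇ᵢ ≤ −r` on the shell for some `r > 0`.
[cite: KunduAnghel2015acc, Appendix 7.1, display defining `r̄ᵢ¹ := sup_{x∈𝒟ᵢ¹} V̇ᵢ(x) < 0`] -/
theorem exists_rate_of_isCompact [TopologicalSpace E] {D : Set E} {W : E → ℝ} (hD : IsCompact D) (hW : ContinuousOn W D)
    (hneg : ∀ x ∈ D, W x < 0) : ∃ r : ℝ, 0 < r ∧ ∀ x ∈ D, W x ≤ -r := by
  rcases D.eq_empty_or_nonempty with hDe | hDne
  · exact ⟨1, one_pos, fun x hx => by simp [hDe] at hx⟩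
  · obtain ⟨x₀, hx₀, hmax⟩ := hD.exists_isMaxOn hDne hW
    refine ⟨-W x₀, by linarith [hneg x₀ hx₀], fun x hx => ?_⟩
    have := hmax hx
    simp only [mem_setOf_eq] at this
    linarith

variable [NormedAddCommGroup E] [NormedSpace ℝ E] [Finite ι]

/-- **Intermediate boxes are positively invariant.** Under the shell hypothesis
`V̇ᵢ < 0 on 𝒟ᵢᵏ ∀ i` (eq. (cond_asymptotic) at level `k`), every box `{Vᵢ ≤ cᵢ ∀ i}` with
`εᵢᵏ⁺¹ ≤ cᵢ ≤ εᵢᵏ` is positively invariant along solutions on `[0, T]` (tree convention): its active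
faces `{Vᵢ = cᵢ}` lie in the shells. In particular (`c = εᵏ`) «`Vᵢ(t) ≤ εᵢᵏ ∀ t ≥ t₀`» and
(`cᵢ = εᵢᵏ⁺¹`, `cⱼ = εⱼᵏ`) «`Vᵢ(t) < εᵢ¹ ∀ t ≥ tᵢ¹`» of the printed proof.
[cite: KunduAnghel2015acc, §4.1 Lemma 1; Appendix 7.1 eq. (proof_tk) (first display)] -/
theorem levelBox_invariant_of_shell {F : E → E} {V : ι → E → ℝ} {V' : ι → E → E →L[ℝ] ℝ}
    {ε : ι → ℕ → ℝ} (hV : ∀ i x, HasFDerivAt (V i) (V' i x) x) {k : ℕ}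
    (hdec : ∀ i, ∀ x ∈ descentShell V ε i k, V' i x (F x) < 0)
    {c : ι → ℝ} (hc1 : ∀ i, ε i (k + 1) ≤ c i) (hc2 : ∀ i, c i ≤ ε i k)
    {X : ℝ → E} {T : ℝ} (hX : ∀ t ∈ Icc 0 T, HasDerivWithinAt X (F (X t)) (Icc 0 T) t)
    (h0 : X 0 ∈ levelBox V c) : ∀ t ∈ Icc 0 T, X t ∈ levelBox V c := by
  have key := forall_le_of_solution_of_active_lt (F := F) (g := V) (g' := V') (c := c) hV
    (fun x hall i hi => hdec i x
      ⟨by rw [hi]; exact hc1 i, by rw [hi]; exact hc2 i, fun j _ => (hall j).trans (hc2 j)⟩) hX h0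
  intro t ht i
  exact key t ht i

/-- Global-solution form of `levelBox_invariant_of_shell`: a solution on every `[0, T]` starting in an
intermediate box stays in it for all `t ≥ 0`. [cite: KunduAnghel2015acc, §4.1 Lemma 1; Appendix 7.1] -/
theorem levelBox_invariant_of_shell' {F : E → E} {V : ι → E → ℝ} {V' : ι → E → E →L[ℝ] ℝ}
    {ε : ι → ℕ → ℝ} (hV : ∀ i x, HasFDerivAt (V i) (V' i x) x) {k : ℕ}
    (hdec : ∀ i, ∀ x ∈ descentShell V ε i k, V' i x (F x) < 0)
    {c : ι → ℝ} (hc1 : ∀ i, ε i (k + 1) ≤ c i) (hc2 : ∀ i, c i ≤ ε i k)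
    {X : ℝ → E} (hX : ∀ T : ℝ, ∀ t ∈ Icc 0 T, HasDerivWithinAt X (F (X t)) (Icc 0 T) t)
    (h0 : X 0 ∈ levelBox V c) : ∀ t, 0 ≤ t → X t ∈ levelBox V c :=
  fun t ht => levelBox_invariant_of_shell hV hdec hc1 hc2 (hX t) h0 t ⟨ht, le_rfl⟩

/-- **One descent step** (eq. (proof_tk)): let `V̇ᵢ ≤ −rᵢ < 0` on the shell `𝒟ᵢᵏ` for every `i`
(`εᵢᵏ⁺¹ ≤ εᵢᵏ`), and let a global solution `X` lie in the box of level `k` for all `t ≥ t₀ ≥ 0`. Then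
for `t ≥ t₀ + Δ`, `Δ ≥ (εᵢᵏ − εᵢᵏ⁺¹)/rᵢ ∀ i`, it lies in the box of level `k + 1`: as long as
`Vᵢ > εᵢᵏ⁺¹` the solution is in `𝒟ᵢᵏ`, so `Vᵢ + rᵢ t` is non-increasing and `Vᵢ` reaches `εᵢᵏ⁺¹` by
time `t₀ + (εᵢᵏ − εᵢᵏ⁺¹)/rᵢ` (printed: «`∃ tᵢ¹ < t₀ + (εᵢ¹−εᵢ⁰)/r̄ᵢ¹` s.t. `Vᵢ(t) < εᵢ¹ ∀ t ≥ tᵢ¹`»), after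
which the box `{Vᵢ ≤ εᵢᵏ⁺¹, Vⱼ ≤ εⱼᵏ}` is invariant.
[cite: KunduAnghel2015acc, Appendix 7.1 eq. (proof_tk) and the two displays before it] -/
theorem levelBox_succ_of_shell {F : E → E} {V : ι → E → ℝ} {V' : ι → E → E →L[ℝ] ℝ}
    {ε : ι → ℕ → ℝ} {r : ι → ℝ} (hV : ∀ i x, HasFDerivAt (V i) (V' i x) x) {k : ℕ}
    (hε : ∀ i, ε i (k + 1) ≤ ε i k) (hr0 : ∀ i, 0 < r i)
    (hr : ∀ i, ∀ x ∈ descentShell V ε i k, V' i x (F x) ≤ -r i)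
    {X : ℝ → E} (hX : ∀ T : ℝ, ∀ t ∈ Icc 0 T, HasDerivWithinAt X (F (X t)) (Icc 0 T) t)
    {t₀ Δ : ℝ} (ht₀ : 0 ≤ t₀) (hbox : ∀ t, t₀ ≤ t → X t ∈ levelBox V (fun i => ε i k))
    (hΔ : ∀ i, (ε i k - ε i (k + 1)) / r i ≤ Δ) :
    ∀ t, t₀ + Δ ≤ t → X t ∈ levelBox V (fun i => ε i (k + 1)) := by
  classical
  have hdec : ∀ i, ∀ x ∈ descentShell V ε i k, V' i x (F x) < 0 :=
    fun i x hx => (hr i x hx).trans_lt (by linarith [hr0 i])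
  intro t ht i
  set Δi : ℝ := (ε i k - ε i (k + 1)) / r i with hΔi
  have hΔi0 : 0 ≤ Δi := div_nonneg (by linarith [hε i]) (hr0 i).le
  -- Step 1: `Vᵢ` reaches the level `εᵢᵏ⁺¹` by time `t₀ + Δi`
  have hreach : ∃ s, t₀ ≤ s ∧ s ≤ t₀ + Δi ∧ V i (X s) ≤ ε i (k + 1) := by
    by_contra H
    push Not at H
    -- on `[t₀, t₀ + Δi]` the solution is in the shell `𝒟ᵢᵏ`
    have hshell : ∀ s ∈ Icc t₀ (t₀ + Δi), X s ∈ descentShell V ε i k := fun s hs =>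
      ⟨(H s hs.1 hs.2).le, (hbox s hs.1) i, fun j _ => (hbox s hs.1) j⟩
    set g : ℝ → ℝ := fun s => V i (X s) with hg
    have hsub : Icc t₀ (t₀ + Δi) ⊆ Icc 0 (t₀ + Δi) := fun s hs => ⟨ht₀.trans hs.1, hs.2⟩
    have hgder : ∀ s ∈ Icc t₀ (t₀ + Δi),
        HasDerivWithinAt g (V' i (X s) (F (X s))) (Icc 0 (t₀ + Δi)) s := fun s hs =>
      (hV i (X s)).comp_hasDerivWithinAt s (hX (t₀ + Δi) s (hsub hs))
    set φ : ℝ → ℝ := fun s => g s + r i * s with hφ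
    have hanti : AntitoneOn φ (Icc t₀ (t₀ + Δi)) := by
      refine antitoneOn_of_hasDerivWithinAt_nonpos (convex_Icc _ _)
        (f' := fun s => V' i (X s) (F (X s)) + r i) ?_ ?_ ?_
      · intro s hs
        exact (((hgder s hs).continuousWithinAt.mono hsub).add
          (continuous_const.mul continuous_id).continuousWithinAt)
      · intro s hs
        have hs' : s ∈ Icc t₀ (t₀ + Δi) := interior_subset hs
        exact (((hgder s hs').mono (interior_subset.trans hsub)).add
          ((hasDerivWithinAt_id s _).const_mul (r i))).congr_deriv (by simp)
      · intro s hs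
        have := hr i (X s) (hshell s (interior_subset hs))
        linarith
    have hmono := hanti (left_mem_Icc.2 (by linarith)) (right_mem_Icc.2 (by linarith)) (by linarith)
    simp only [hφ] at hmono
    have hg0 : g t₀ ≤ ε i k := (hbox t₀ le_rfl) i
    have hrΔ : r i * Δi = ε i k - ε i (k + 1) := by
      rw [hΔi]; field_simp [(hr0 i).ne']
    have hend : g (t₀ + Δi) ≤ ε i (k + 1) := by nlinarith
    exact absurd hend (not_le.2 (H (t₀ + Δi) (by linarith) le_rfl))
  -- Step 2: from that time on, the box `{Vᵢ ≤ εᵢᵏ⁺¹, Vⱼ ≤ εⱼᵏ}` is invariant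
  obtain ⟨s, hs0, hs1, hsV⟩ := hreach
  set c : ι → ℝ := Function.update (fun j => ε j k) i (ε i (k + 1)) with hc
  have hc1 : ∀ j, ε j (k + 1) ≤ c j := fun j => by
    rcases eq_or_ne j i with hji | hji
    · subst hji; simp [hc]
    · simp [hc, hji, hε j]
  have hc2 : ∀ j, c j ≤ ε j k := fun j => by
    rcases eq_or_ne j i with hji | hji
    · subst hji; simp [hc, hε j]
    · simp [hc, hji]
  have hY := hasDerivWithinAt_comp_add_of_solution hX (ht₀.trans hs0)
  have hY0 : (fun u => X (s + u)) 0 ∈ levelBox V c := fun j => by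
    rcases eq_or_ne j i with hji | hji
    · subst hji; simpa [hc] using hsV
    · simpa [hc, hji] using (hbox s hs0) j
  have hstay := levelBox_invariant_of_shell' (F := F) hV hdec hc1 hc2 hY hY0 (t - s)
    (by linarith [hΔ i])
  have : X t ∈ levelBox V c := by simpa using hstay
  simpa [hc] using this i

/-- **All levels are reached** (eq. (proof_tk) by induction): under the shell-rate hypotheses at every
level, a global solution starting in the top box `{Vᵢ ≤ εᵢ⁰}` is, for every `k`, inside the box
`{Vᵢ ≤ εᵢᵏ}` from some time `tᵏ ≥ 0` on.
[cite: KunduAnghel2015acc, Appendix 7.1 eq. (proof_tk)] -/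
theorem exists_forall_mem_levelBox_of_shell {F : E → E} {V : ι → E → ℝ} {V' : ι → E → E →L[ℝ] ℝ}
    {ε : ι → ℕ → ℝ} {r : ι → ℕ → ℝ} (hV : ∀ i x, HasFDerivAt (V i) (V' i x) x)
    (hε : ∀ i k, ε i (k + 1) ≤ ε i k) (hr0 : ∀ i k, 0 < r i k)
    (hr : ∀ i k, ∀ x ∈ descentShell V ε i k, V' i x (F x) ≤ -r i k)
    {X : ℝ → E} (hX : ∀ T : ℝ, ∀ t ∈ Icc 0 T, HasDerivWithinAt X (F (X t)) (Icc 0 T) t)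
    (h0 : X 0 ∈ levelBox V (fun i => ε i 0)) (k : ℕ) :
    ∃ tk : ℝ, 0 ≤ tk ∧ ∀ t, tk ≤ t → X t ∈ levelBox V (fun i => ε i k) := by
  have hdec : ∀ i k, ∀ x ∈ descentShell V ε i k, V' i x (F x) < 0 :=
    fun i k x hx => (hr i k x hx).trans_lt (by linarith [hr0 i k])
  induction k with
  | zero =>
    exact ⟨0, le_rfl, levelBox_invariant_of_shell' (k := 0) hV (fun i => hdec i 0)
      (fun i => hε i 0) (fun _ => le_rfl) hX h0⟩
  | succ k ih =>
    obtain ⟨tk, htk0, htk⟩ := ih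
    set Δ : ℝ := ⨆ i, (ε i k - ε i (k + 1)) / r i k with hΔdef
    have hΔ : ∀ i, (ε i k - ε i (k + 1)) / r i k ≤ Δ :=
      fun i => le_ciSup (f := fun i => (ε i k - ε i (k + 1)) / r i k) (Set.finite_range _).bddAbove i
    have hΔ0 : 0 ≤ Δ := by
      rcases isEmpty_or_nonempty ι with hE | ⟨⟨i⟩⟩
      · simp [hΔdef, Real.iSup_of_isEmpty]
      · exact (div_nonneg (by linarith [hε i k]) (hr0 i k).le).trans (hΔ i)
    exact ⟨tk + Δ, by linarith, levelBox_succ_of_shell hV (fun i => hε i k) (fun i => hr0 i k)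
      (fun i => hr i k) hX htk0 htk hΔ⟩

/-- **Kundu–Anghel Lemma 1 (compositional certificate ⇒ asymptotic stability), printed conclusion.**
Finitely many Lyapunov functionals `Vᵢ` with derivatives `Vᵢ'`, level sequences `εᵢᵏ` non-increasing
in `k` and tending to `0`, and shell rates `V̇ᵢ ≤ −rᵢᵏ < 0` on `𝒟ᵢᵏ`: every global solution from the box
`{Vᵢ ≤ εᵢ⁰ ∀ i}` satisfies «`∀ δ > 0 ∃ t* ∀ t ≥ t*, Vᵢ(t) < δ ∀ i`» (the last display of the printed
proof). The per-shell conditions are what the local SOS programmes (cond_asymptotic_SOS) certify; nothing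
global in the state dimension is required. [cite: KunduAnghel2015acc, §4.1 Lemma 1, Appendix 7.1
(eqs. (proof_delta), (proof_tk) and the final display)] -/
theorem forall_eventually_lt_of_shell {F : E → E} {V : ι → E → ℝ} {V' : ι → E → E →L[ℝ] ℝ}
    {ε : ι → ℕ → ℝ} {r : ι → ℕ → ℝ} (hV : ∀ i x, HasFDerivAt (V i) (V' i x) x)
    (hε : ∀ i k, ε i (k + 1) ≤ ε i k) (hlim : ∀ i, Tendsto (ε i) atTop (𝓝 0))
    (hr0 : ∀ i k, 0 < r i k) (hr : ∀ i k, ∀ x ∈ descentShell V ε i k, V' i x (F x) ≤ -r i k)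
    {X : ℝ → E} (hX : ∀ T : ℝ, ∀ t ∈ Icc 0 T, HasDerivWithinAt X (F (X t)) (Icc 0 T) t)
    (h0 : X 0 ∈ levelBox V (fun i => ε i 0)) {δ : ℝ} (hδ : 0 < δ) :
    ∃ T : ℝ, 0 ≤ T ∧ ∀ t, T ≤ t → ∀ i, V i (X t) < δ := by
  -- (proof_delta): a common index `K` with `εᵢᴷ < δ` for all `i`
  have hK : ∀ᶠ k in atTop, ∀ i, ε i k < δ :=
    Filter.eventually_all.2 fun i => (hlim i).eventually (Iio_mem_nhds hδ)
  obtain ⟨K, hK⟩ := hK.exists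
  obtain ⟨tK, htK0, htK⟩ := exists_forall_mem_levelBox_of_shell hV hε hr0 hr hX h0 K
  exact ⟨tK, htK0, fun t ht i => ((htK t ht) i).trans_lt (hK i)⟩

/-- Lemma 1 with non-negative Lyapunov functionals: each `Vᵢ(X t) → 0` as `t → ∞`.
[cite: KunduAnghel2015acc, §4.1 Lemma 1 with §3 eq. (cond_asymp) («`lim_{t→∞} Vᵢ(xᵢ(t)) = 0`»)] -/
theorem tendsto_zero_of_shell {F : E → E} {V : ι → E → ℝ} {V' : ι → E → E →L[ℝ] ℝ}
    {ε : ι → ℕ → ℝ} {r : ι → ℕ → ℝ} (hV : ∀ i x, HasFDerivAt (V i) (V' i x) x)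
    (hV0 : ∀ i x, 0 ≤ V i x)
    (hε : ∀ i k, ε i (k + 1) ≤ ε i k) (hlim : ∀ i, Tendsto (ε i) atTop (𝓝 0))
    (hr0 : ∀ i k, 0 < r i k) (hr : ∀ i k, ∀ x ∈ descentShell V ε i k, V' i x (F x) ≤ -r i k)
    {X : ℝ → E} (hX : ∀ T : ℝ, ∀ t ∈ Icc 0 T, HasDerivWithinAt X (F (X t)) (Icc 0 T) t)
    (h0 : X 0 ∈ levelBox V (fun i => ε i 0)) (i : ι) :
    Tendsto (fun t => V i (X t)) atTop (𝓝 0) := by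
  rw [Metric.tendsto_atTop]
  intro δ hδ
  obtain ⟨T, -, hT⟩ := forall_eventually_lt_of_shell hV hε hlim hr0 hr hX h0 hδ
  refine ⟨T, fun t ht => ?_⟩
  rw [Real.dist_eq, sub_zero, abs_of_nonneg (hV0 i (X t))]
  exact hT t ht i

/-- **Lemma 1 as a region-of-attraction statement**: if moreover the boxes `{Vᵢ ≤ εᵢᵏ}` shrink to the
equilibrium `x₀` (every neighbourhood of `x₀` contains one of them — true for positive definite,
proper `Vᵢ(xᵢ)` vanishing exactly at `x₀`), every global solution from the top box tends to `x₀`: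
«the system is asymptotically stable in the domain `{⋂ᵢ Vᵢ(xᵢ) ≤ εᵢ⁰}`» (attractivity half; the
invariance half is `levelBox_invariant_of_shell'`). [cite: KunduAnghel2015acc, §4.1 Lemma 1] -/
theorem tendsto_of_shell {F : E → E} {V : ι → E → ℝ} {V' : ι → E → E →L[ℝ] ℝ}
    {ε : ι → ℕ → ℝ} {r : ι → ℕ → ℝ} {x₀ : E} (hV : ∀ i x, HasFDerivAt (V i) (V' i x) x)
    (hε : ∀ i k, ε i (k + 1) ≤ ε i k) (hr0 : ∀ i k, 0 < r i k)
    (hr : ∀ i k, ∀ x ∈ descentShell V ε i k, V' i x (F x) ≤ -r i k)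
    (hshrink : ∀ U ∈ 𝓝 x₀, ∃ k, levelBox V (fun i => ε i k) ⊆ U)
    {X : ℝ → E} (hX : ∀ T : ℝ, ∀ t ∈ Icc 0 T, HasDerivWithinAt X (F (X t)) (Icc 0 T) t)
    (h0 : X 0 ∈ levelBox V (fun i => ε i 0)) : Tendsto X atTop (𝓝 x₀) := by
  rw [tendsto_atTop_nhds]
  intro U hU hUo
  obtain ⟨k, hk⟩ := hshrink U (hUo.mem_nhds hU)
  obtain ⟨tk, -, htk⟩ := exists_forall_mem_levelBox_of_shell hV hε hr0 hr hX h0 k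
  exact ⟨tk, fun t ht => hk (htk t ht)⟩

/-- **Global solutions from the top box** (the source argues with trajectories for all `t ≥ t₀`): in a
proper complete space, for a `C¹` field and a BOUNDED top box `{Vᵢ ≤ εᵢ⁰}` whose faces lie in shells
with `V̇ᵢ < 0`, from every point of the box there is a solution on every `[0, T]` (a priori confinement
by `levelBox_invariant_of_shell` + the tree's `exists_solution_of_apriori_bound`).
[cite: KunduAnghel2015acc, §4.1 Lemma 1 (solutions of (E:f) from the domain); Appendix 7.1] -/
theorem exists_global_solution_of_shell [ProperSpace E] [CompleteSpace E] {F : E → E}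
    {V : ι → E → ℝ} {V' : ι → E → E →L[ℝ] ℝ} {ε : ι → ℕ → ℝ}
    (hV : ∀ i x, HasFDerivAt (V i) (V' i x) x) (hε : ∀ i, ε i 1 ≤ ε i 0)
    (hdec : ∀ i, ∀ x ∈ descentShell V ε i 0, V' i x (F x) < 0) (hF : ContDiff ℝ 1 F)
    (hbdd : Bornology.IsBounded (levelBox V (fun i => ε i 0))) {x₀ : E}
    (hx₀ : x₀ ∈ levelBox V (fun i => ε i 0)) :
    ∃ X : ℝ → E, X 0 = x₀ ∧ ∀ T : ℝ, ∀ t ∈ Icc 0 T, HasDerivWithinAt X (F (X t)) (Icc 0 T) t := by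
  have hlip : ∀ T ρ : ℝ, ∃ K : NNReal, ∀ t ∈ Icc 0 T,
      LipschitzOnWith K ((fun _ : ℝ => F) t) (closedBall 0 ρ) := by
    intro T ρ
    obtain ⟨K, hK⟩ := exists_lipschitzOnWith_of_isCompact isOpen_univ hF.contDiffOn
      (isCompact_closedBall (0 : E) ρ) (subset_univ _)
    exact ⟨K, fun _ _ => hK⟩
  have hcont : ∀ x : E, ContinuousOn (fun t : ℝ => (fun _ : ℝ => F) t x) (Ici 0) :=
    fun _ => continuousOn_const
  obtain ⟨R, hR⟩ := hbdd.subset_closedBall (0 : E)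
  have hapriori : ∀ T : ℝ, 0 ≤ T → ∃ R : ℝ, ‖x₀‖ ≤ R ∧ ∀ s ∈ Icc 0 T, ∀ α : ℝ → E, α 0 = x₀ →
      (∀ t ∈ Icc 0 s, HasDerivWithinAt α ((fun _ : ℝ => F) t (α t)) (Icc 0 s) t) →
      ∀ t ∈ Icc 0 s, ‖α t‖ ≤ R := by
    intro T _
    refine ⟨R, ?_, fun s _ X hX0 hX t ht => ?_⟩
    · simpa using hR hx₀
    · have h0 : X 0 ∈ levelBox V (fun i => ε i 0) := by rw [hX0]; exact hx₀
      have h := levelBox_invariant_of_shell (k := 0) hV hdec hε (fun _ => le_rfl) hX h0 t ht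
      simpa using hR h
  exact exists_solution_of_apriori_bound hlip hcont hapriori

end Literature.Analysis.ODE
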